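import Literature.Analysis.FunctionSpaces.LittlewoodPaleyHeatProofs
import Literature.Analysis.UnboundedOperators.HeatKernelFourier
import Literature.Analysis.UnboundedOperators.HeatKernelHeatEquation
import Mathlib.Analysis.Fourier.FourierTransformDeriv
import HarnessLib

/-!
# The Gaussian and the Gauss–Weierstrass kernel as Schwartz functions; derivatives of the kernel

Everything in this file is proved (no named facts). It supplies the function-space side of the
heat kernel needed by the Navier–Stokes local Cauchy theory in critical spaces (Kato's approach:
Lemarié-Rieusset, *The Navier–Stokes Problem in the 21st Century* (2016), §4.5 and §7.6), namely
that the Gauss–Weierstrass kernel `W_t = heatKernel t` and **all its derivatives** are integrable,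
bounded, rapidly decreasing, with the parabolic scaling in `t`, and that the Fourier transform of
`Dⁿ W_t` is `(2πi ⟪ξ, ·⟫)^{⊗ n} e^{-(2π)² t ‖ξ‖²}`.

## Contents

* `Literature.Analysis.FunctionSpaces.norm_iteratedFDeriv_exp_neg_mul_norm_sq_le`: the Faà di Bruno bound
  `‖Dᴺ e^{-a‖·‖²}(x)‖ ≤ N! (max 1 a)ᴺ (max (2‖x‖) 2)ᴺ e^{-a‖x‖²}` (`0 ≤ a`), whence the Gaussian
  is a Schwartz function: `Literature.realGaussianSchwartz E a : 𝓢(E, ℝ)` and its complexification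
  `Literature.gaussianSchwartz E a : 𝓢(E, ℂ)` (`0 < a`; junk value `0` otherwise);
* `Literature.heatKernelSchwartzReal E t : 𝓢(E, ℝ)`, `Literature.heatKernelSchwartz E t : 𝓢(E, ℂ)`: the
  Gauss–Weierstrass kernel `W_t(x) = (4πt)^{-d/2} e^{-‖x‖²/(4t)}` (`Literature.Analysis.UnboundedOperators.heatKernel`) as a Schwartz
  function for `0 < t`, and `gaussianSchwartz E ((2π)² t) = heatSymbol t` (the Fourier side);
* consequences: `Dⁿ W_t` is continuous, bounded, integrable together with all polynomial weights
  (`Literature.Analysis.FunctionSpaces.integrable_pow_mul_norm_iteratedFDeriv_heatKernel`, `Literature.Analysis.FunctionSpaces.integrable_iteratedFDeriv_heatKernel`,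
  `Literature.Analysis.FunctionSpaces.exists_norm_iteratedFDeriv_heatKernel_le`);
* the parabolic scaling `Dⁿ W_s (x) = s^{-(d+n)/2} (Dⁿ W_1)(x/√s)`
  (`Literature.Analysis.FunctionSpaces.iteratedFDeriv_heatKernel_eq_smul`), the resulting bounds
  `‖Dⁿ W_s‖_{L^∞} ≤ s^{-(d+n)/2} ‖Dⁿ W_1‖_{L^∞}`, `‖Dⁿ W_s‖_{L¹} = s^{-n/2} ‖Dⁿ W_1‖_{L¹}`, and the
  joint continuity of `(s, x) ↦ Dⁿ W_s (x)` on `(0, ∞) × E`;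
* the Fourier transform of the derivatives: `𝓕 (Dⁿ W_t) (ξ) (m₁, …, mₙ) =
  (2πi)ⁿ ⟪ξ, m₁⟫ ⋯ ⟪ξ, mₙ⟫ e^{-(2π)² t ‖ξ‖²}` (`Literature.Analysis.FunctionSpaces.fourier_iteratedFDeriv_heatKernel_apply` and its
  scalar-entry form `Literature.Analysis.FunctionSpaces.fourier_iteratedFDeriv_heatKernel_apply_ofReal`; Mathlib's
  `Real.fourier_iteratedFDeriv` and the tree's `Literature.Analysis.UnboundedOperators.fourierIntegral_heatKernel_holds`).

## References

* P. G. Lemarié-Rieusset, *The Navier–Stokes Problem in the 21st Century*, CRC Press (2016),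
  §4.5 (the heat kernel `W_{νt}` and the Oseen tensor, Def. 4.2, p. 50 of the printed edition) and
  §7.6 (Kato's mild solutions in Lebesgue spaces, Prop. 7.3). [cite: LemarieRieusset2016, §4.5]
* E. M. Stein, *Singular Integrals and Differentiability Properties of Functions* (1970),
  Ch. III §2 (the Gauss–Weierstrass kernel). [cite: SteinSingularIntegrals1970, Ch. III §2]
* L. C. Evans, *Partial Differential Equations*, §2.3.1 (the fundamental solution of the heat
  equation and its scaling). [cite: Evans2010, §2.3.1]
-/

noncomputable section

open MeasureTheory SchwartzMap Filter Topology Function Set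
open scoped SchwartzMap ENNReal NNReal FourierTransform Real ContDiff RealInnerProductSpace

namespace Literature.Analysis.FunctionSpaces

/-! ## Faà di Bruno bounds for the Gaussian -/

section Decay

/-- Derivatives of `y ↦ e^{c y}` on `ℝ`: `‖Dⁱ e^{c·}(y)‖ = |c|ⁱ e^{c y}`
(`iteratedDeriv_exp_const_mul`). [folklore] -/
theorem norm_iteratedFDeriv_exp_const_mul (c : ℝ) (i : ℕ) (y : ℝ) :
    ‖iteratedFDeriv ℝ i (fun s : ℝ => Real.exp (c * s)) y‖ = |c| ^ i * Real.exp (c * y) := by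
  rw [norm_iteratedFDeriv_eq_norm_iteratedDeriv, iteratedDeriv_exp_const_mul, norm_mul, norm_pow,
    Real.norm_eq_abs, Real.norm_of_nonneg (Real.exp_pos _).le]

variable {E : Type*} [NormedAddCommGroup E] [InnerProductSpace ℝ E]

omit [InnerProductSpace ℝ E] in
/-- The Gaussian `e^{-a‖·‖²}` as the composition `(y ↦ e^{-a y}) ∘ ‖·‖²`. [folklore] -/
theorem exp_neg_mul_norm_sq_eq_comp [NormedSpace ℝ E] (a : ℝ) :
    (fun x : E => Real.exp (-a * ‖x‖ ^ 2)) = (fun s : ℝ => Real.exp (-a * s)) ∘ fun x : E => ‖x‖ ^ 2 :=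
  rfl

/-- The Gaussian `e^{-a‖·‖²}` is smooth on a real inner product space. [folklore] -/
theorem contDiff_exp_neg_mul_norm_sq (a : ℝ) {n : WithTop ℕ∞} :
    ContDiff ℝ n (fun x : E => Real.exp (-a * ‖x‖ ^ 2)) :=
  (Real.contDiff_exp.comp (contDiff_const.mul (contDiff_norm_sq ℝ))).of_le le_top

/-- **Faà di Bruno bound for the Gaussian.** For `0 ≤ a` and all `N`, `x`:
`‖Dᴺ e^{-a‖·‖²}(x)‖ ≤ N! (max 1 a)ᴺ (max (2‖x‖) 2)ᴺ e^{-a‖x‖²}` (Mathlib's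
`norm_iteratedFDeriv_comp_le` for `(y ↦ e^{-ay}) ∘ ‖·‖²`, with `‖Dⁱ e^{-a·}‖ ≤ aⁱ e^{-a·}` and
`‖Dⁱ ‖·‖²(x)‖ ≤ (max (2‖x‖) 2)ⁱ`, `Literature.Analysis.FunctionSpaces.norm_iteratedFDeriv_norm_sq_le`). The global twin of
`Literature.Analysis.FunctionSpaces.norm_iteratedFDeriv_heatSymbol_le_exp_neg` (which trades the polynomial factor for half of the
exponential on an annulus). [folklore] -/
theorem norm_iteratedFDeriv_exp_neg_mul_norm_sq_le {a : ℝ} (ha : 0 ≤ a) (N : ℕ) (x : E) :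
    ‖iteratedFDeriv ℝ N (fun x : E => Real.exp (-a * ‖x‖ ^ 2)) x‖ ≤
      N.factorial * (max 1 a) ^ N * (max (2 * ‖x‖) 2) ^ N * Real.exp (-a * ‖x‖ ^ 2) := by
  have hg : ContDiff ℝ ∞ (fun s : ℝ => Real.exp (-a * s)) := by fun_prop
  have hf : ContDiff ℝ ∞ (fun ξ : E => ‖ξ‖ ^ 2) := contDiff_norm_sq ℝ
  have hC : ∀ i ≤ N, ‖iteratedFDeriv ℝ i (fun s : ℝ => Real.exp (-a * s)) (‖x‖ ^ 2)‖ ≤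
      (max 1 a) ^ N * Real.exp (-a * ‖x‖ ^ 2) := by
    intro i hi
    rw [norm_iteratedFDeriv_exp_const_mul, abs_neg, abs_of_nonneg ha]
    exact mul_le_mul_of_nonneg_right
      ((pow_le_pow_left₀ ha (le_max_right 1 a) i).trans (pow_le_pow_right₀ (le_max_left 1 a) hi))
      (Real.exp_pos _).le
  have hD : ∀ i, 1 ≤ i → i ≤ N → ‖iteratedFDeriv ℝ i (fun ξ : E => ‖ξ‖ ^ 2) x‖ ≤
      (max (2 * ‖x‖) 2) ^ i := fun i hi _ => norm_iteratedFDeriv_norm_sq_le x hi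
  have hmain := norm_iteratedFDeriv_comp_le hg hf (mod_cast le_top) x hC hD
  rw [exp_neg_mul_norm_sq_eq_comp]
  refine hmain.trans (le_of_eq ?_)
  ring

/-- `(max r 1)ᴹ e^{-a r²} ≤ 1 + M!/aᴹ` for `0 < a` and real `r`: the polynomial weights are absorbed by
the Gaussian (`xᴹ/M! ≤ eˣ`, Mathlib's `Real.pow_div_factorial_le_exp`). [folklore] -/
theorem max_pow_mul_exp_neg_mul_sq_le {a : ℝ} (ha : 0 < a) (M : ℕ) (r : ℝ) :
    (max r 1) ^ M * Real.exp (-a * r ^ 2) ≤ 1 + M.factorial / a ^ M := by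
  have hfa : 0 ≤ (M.factorial : ℝ) / a ^ M := by positivity
  rcases le_total r 1 with h | h
  · rw [max_eq_right h, one_pow, one_mul]
    have : Real.exp (-a * r ^ 2) ≤ 1 := by
      rw [Real.exp_le_one_iff]
      nlinarith [sq_nonneg r]
    linarith
  · rw [max_eq_left h]
    have h1 : r ^ M ≤ (r ^ 2) ^ M := by
      rw [← pow_mul]
      exact pow_le_pow_right₀ h (by omega)
    have h2 := Real.pow_div_factorial_le_exp (a * r ^ 2) (by positivity) M
    rw [div_le_iff₀ (by positivity)] at h2
    have h3 : (r ^ 2) ^ M ≤ M.factorial * Real.exp (a * r ^ 2) / a ^ M := by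
      rw [le_div_iff₀ (by positivity)]
      calc (r ^ 2) ^ M * a ^ M = (a * r ^ 2) ^ M := by rw [mul_pow]; ring
        _ ≤ Real.exp (a * r ^ 2) * M.factorial := h2
        _ = M.factorial * Real.exp (a * r ^ 2) := mul_comm _ _
    calc r ^ M * Real.exp (-a * r ^ 2)
        ≤ (M.factorial * Real.exp (a * r ^ 2) / a ^ M) * Real.exp (-a * r ^ 2) :=
          mul_le_mul_of_nonneg_right (h1.trans h3) (Real.exp_pos _).le
      _ = M.factorial / a ^ M := by
          rw [div_mul_eq_mul_div, mul_assoc, ← Real.exp_add, show a * r ^ 2 + -a * r ^ 2 = 0 by ring,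
            Real.exp_zero, mul_one]
      _ ≤ 1 + M.factorial / a ^ M := le_add_of_nonneg_left zero_le_one

/-- **Schwartz decay of the Gaussian**: for `0 < a` and all `k, n`,
`‖x‖ᵏ ‖Dⁿ e^{-a‖·‖²}(x)‖ ≤ n! (max 1 a)ⁿ 2ⁿ (1 + (n+k)!/a^{n+k})`. [folklore] -/
theorem pow_mul_norm_iteratedFDeriv_exp_neg_mul_norm_sq_le {a : ℝ} (ha : 0 < a) (k n : ℕ) (x : E) :
    ‖x‖ ^ k * ‖iteratedFDeriv ℝ n (fun x : E => Real.exp (-a * ‖x‖ ^ 2)) x‖ ≤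
      n.factorial * (max 1 a) ^ n * 2 ^ n * (1 + (n + k).factorial / a ^ (n + k)) := by
  have h := norm_iteratedFDeriv_exp_neg_mul_norm_sq_le ha.le n x
  have hmax : max (2 * ‖x‖) 2 = 2 * max ‖x‖ 1 := by
    rcases le_total ‖x‖ 1 with h1 | h1
    · rw [max_eq_right h1, max_eq_right (by linarith)]
      ring
    · rw [max_eq_left h1, max_eq_left (by linarith)]
  have hxk : ‖x‖ ^ k ≤ (max ‖x‖ 1) ^ k := pow_le_pow_left₀ (norm_nonneg _) (le_max_left _ _) k
  have hM := max_pow_mul_exp_neg_mul_sq_le ha (n + k) ‖x‖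
  have h0 : 0 ≤ (n.factorial : ℝ) * (max 1 a) ^ n * 2 ^ n := by positivity
  calc ‖x‖ ^ k * ‖iteratedFDeriv ℝ n (fun x : E => Real.exp (-a * ‖x‖ ^ 2)) x‖
      ≤ ‖x‖ ^ k * (n.factorial * (max 1 a) ^ n * (max (2 * ‖x‖) 2) ^ n *
          Real.exp (-a * ‖x‖ ^ 2)) := by gcongr
    _ = n.factorial * (max 1 a) ^ n * 2 ^ n *
          ((max ‖x‖ 1) ^ n * ‖x‖ ^ k * Real.exp (-a * ‖x‖ ^ 2)) := by
        rw [hmax, mul_pow]; ring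
    _ ≤ n.factorial * (max 1 a) ^ n * 2 ^ n *
          ((max ‖x‖ 1) ^ n * (max ‖x‖ 1) ^ k * Real.exp (-a * ‖x‖ ^ 2)) := by gcongr
    _ = n.factorial * (max 1 a) ^ n * 2 ^ n *
          ((max ‖x‖ 1) ^ (n + k) * Real.exp (-a * ‖x‖ ^ 2)) := by rw [pow_add]
    _ ≤ n.factorial * (max 1 a) ^ n * 2 ^ n * (1 + (n + k).factorial / a ^ (n + k)) := by
        gcongr

omit [InnerProductSpace ℝ E] in
/-- The complexified Gaussian is the real one followed by the isometry `ℝ → ℂ`. [folklore] -/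
theorem ofReal_exp_neg_mul_norm_sq_eq_comp [NormedSpace ℝ E] (a : ℝ) :
    (fun x : E => ((Real.exp (-a * ‖x‖ ^ 2) : ℝ) : ℂ)) =
      Complex.ofRealCLM ∘ fun x : E => Real.exp (-a * ‖x‖ ^ 2) :=
  rfl

/-- The complexified Gaussian is smooth. [folklore] -/
theorem contDiff_ofReal_exp_neg_mul_norm_sq (a : ℝ) {n : WithTop ℕ∞} :
    ContDiff ℝ n (fun x : E => ((Real.exp (-a * ‖x‖ ^ 2) : ℝ) : ℂ)) := by
  rw [ofReal_exp_neg_mul_norm_sq_eq_comp]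
  exact Complex.ofRealCLM.contDiff.comp (contDiff_exp_neg_mul_norm_sq a)

/-- Complexification does not change the norms of the derivatives of the Gaussian
(`ℝ → ℂ` is a linear isometry). [folklore] -/
theorem norm_iteratedFDeriv_ofReal_exp_neg_mul_norm_sq (a : ℝ) (n : ℕ) (x : E) :
    ‖iteratedFDeriv ℝ n (fun x : E => ((Real.exp (-a * ‖x‖ ^ 2) : ℝ) : ℂ)) x‖ =
      ‖iteratedFDeriv ℝ n (fun x : E => Real.exp (-a * ‖x‖ ^ 2)) x‖ := by
  rw [ofReal_exp_neg_mul_norm_sq_eq_comp]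
  exact Complex.ofRealLI.norm_iteratedFDeriv_comp_left
    ((contDiff_exp_neg_mul_norm_sq a (n := ∞)).contDiffAt) (mod_cast le_top)

end Decay

/-! ## The Gaussian as a Schwartz function -/

section Gaussian

variable (E : Type*) [NormedAddCommGroup E] [InnerProductSpace ℝ E]

/-- The **real Gaussian** `x ↦ e^{-a‖x‖²}` as a Schwartz function on the real inner product space
`E`, for `0 < a`; junk value `0` for `a ≤ 0` (see `Literature.Analysis.FunctionSpaces.realGaussianSchwartz_apply`). Stein,
*Singular Integrals*, Ch. III §2. [folklore] -/
def realGaussianSchwartz (a : ℝ) : 𝓢(E, ℝ) :=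
  if ha : 0 < a then
    { toFun := fun x => Real.exp (-a * ‖x‖ ^ 2)
      smooth' := contDiff_exp_neg_mul_norm_sq a
      decay' := fun k n => ⟨_, fun x => pow_mul_norm_iteratedFDeriv_exp_neg_mul_norm_sq_le ha k n x⟩ }
  else 0

/-- The **(complexified) Gaussian** `x ↦ (e^{-a‖x‖²} : ℂ)` as a Schwartz function on the real
inner product space `E`, for `0 < a`; junk value `0` for `a ≤ 0` (see `Literature.Analysis.FunctionSpaces.gaussianSchwartz_apply`).
This is the form consumed by the Fourier transform and by tempered distributions `𝓢'(E, F)`.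
Stein, *Singular Integrals*, Ch. III §2. [folklore] -/
def gaussianSchwartz (a : ℝ) : 𝓢(E, ℂ) :=
  if ha : 0 < a then
    { toFun := fun x => ((Real.exp (-a * ‖x‖ ^ 2) : ℝ) : ℂ)
      smooth' := contDiff_ofReal_exp_neg_mul_norm_sq a
      decay' := fun k n => ⟨_, fun x => by
        rw [norm_iteratedFDeriv_ofReal_exp_neg_mul_norm_sq]
        exact pow_mul_norm_iteratedFDeriv_exp_neg_mul_norm_sq_le ha k n x⟩ }
  else 0

variable {E}

/-- Values of the real Gaussian Schwartz function (`0 < a`). [folklore] -/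
@[simp]
theorem realGaussianSchwartz_apply {a : ℝ} (ha : 0 < a) (x : E) :
    realGaussianSchwartz E a x = Real.exp (-a * ‖x‖ ^ 2) := by
  rw [realGaussianSchwartz, dif_pos ha]
  rfl

/-- Values of the complex Gaussian Schwartz function (`0 < a`). [folklore] -/
@[simp]
theorem gaussianSchwartz_apply {a : ℝ} (ha : 0 < a) (x : E) :
    gaussianSchwartz E a x = ((Real.exp (-a * ‖x‖ ^ 2) : ℝ) : ℂ) := by
  rw [gaussianSchwartz, dif_pos ha]
  rfl

/-- The complex Gaussian Schwartz function as a function (`0 < a`). [folklore] -/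
theorem coe_gaussianSchwartz {a : ℝ} (ha : 0 < a) :
    ⇑(gaussianSchwartz E a) = fun x : E => ((Real.exp (-a * ‖x‖ ^ 2) : ℝ) : ℂ) :=
  funext (gaussianSchwartz_apply ha)

/-- The real Gaussian Schwartz function as a function (`0 < a`). [folklore] -/
theorem coe_realGaussianSchwartz {a : ℝ} (ha : 0 < a) :
    ⇑(realGaussianSchwartz E a) = fun x : E => Real.exp (-a * ‖x‖ ^ 2) :=
  funext (realGaussianSchwartz_apply ha)

/-- **The heat symbol is a Schwartz function** for `0 < t`:
`gaussianSchwartz E ((2π)² t) = (ξ ↦ e^{-(2π)² t ‖ξ‖²}) = heatSymbol t` (the Fourier multiplier of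
`e^{tΔ}`, `Literature.Analysis.UnboundedOperators.heatSymbol`). Stein, *Singular Integrals*, Ch. III §2. [folklore] -/
theorem gaussianSchwartz_heatSymbol_apply {t : ℝ} (ht : 0 < t) (ξ : E) :
    gaussianSchwartz E ((2 * π) ^ 2 * t) ξ = (UnboundedOperators.heatSymbol t ξ : ℂ) := by
  rw [gaussianSchwartz_apply (by positivity), UnboundedOperators.heatSymbol]
  congr 1
  ring_nf

/-- Function form of `Literature.Analysis.FunctionSpaces.gaussianSchwartz_heatSymbol_apply`. [folklore] -/
theorem coe_gaussianSchwartz_heatSymbol {t : ℝ} (ht : 0 < t) :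
    ⇑(gaussianSchwartz E ((2 * π) ^ 2 * t)) = fun ξ : E => (UnboundedOperators.heatSymbol t ξ : ℂ) :=
  funext (gaussianSchwartz_heatSymbol_apply ht)

end Gaussian

/-! ## The Gauss–Weierstrass kernel as a Schwartz function -/

section HeatKernel

variable (E : Type*) [NormedAddCommGroup E] [InnerProductSpace ℝ E]

/-- The **Gauss–Weierstrass kernel as a real Schwartz function**:
`heatKernelSchwartzReal E t = W_t = (4πt)^{-d/2} e^{-‖·‖²/(4t)}` for `0 < t` (`d = dim E`; junk for
`t ≤ 0`, where `realGaussianSchwartz` is `0`). Lemarié-Rieusset 2016, §4.5 (the kernel `W_{νt}`);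
Evans, *PDE*, §2.3.1. [cite: LemarieRieusset2016, §4.5] -/
def heatKernelSchwartzReal (t : ℝ) : 𝓢(E, ℝ) :=
  ((4 * π * t) ^ (-(Module.finrank ℝ E : ℝ) / 2)) • realGaussianSchwartz E (1 / (4 * t))

/-- The **Gauss–Weierstrass kernel as a complex Schwartz function**:
`heatKernelSchwartz E t = (x ↦ (W_t x : ℂ))` for `0 < t` (junk for `t ≤ 0`). Lemarié-Rieusset 2016,
§4.5; Evans, *PDE*, §2.3.1. [cite: LemarieRieusset2016, §4.5] -/
def heatKernelSchwartz (t : ℝ) : 𝓢(E, ℂ) :=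
  (((4 * π * t) ^ (-(Module.finrank ℝ E : ℝ) / 2) : ℝ) : ℂ) • gaussianSchwartz E (1 / (4 * t))

variable {E}

/-- Values of the real Schwartz heat kernel: `heatKernelSchwartzReal E t x = heatKernel t x`
(`0 < t`). [folklore] -/
@[simp]
theorem heatKernelSchwartzReal_apply {t : ℝ} (ht : 0 < t) (x : E) :
    heatKernelSchwartzReal E t x = UnboundedOperators.heatKernel t x := by
  rw [heatKernelSchwartzReal, smul_apply, realGaussianSchwartz_apply (by positivity),
    UnboundedOperators.heatKernel_eq, smul_eq_mul]

/-- The real Schwartz heat kernel as a function (`0 < t`). [folklore] -/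
theorem coe_heatKernelSchwartzReal {t : ℝ} (ht : 0 < t) :
    ⇑(heatKernelSchwartzReal E t) = UnboundedOperators.heatKernel t :=
  funext (heatKernelSchwartzReal_apply ht)

/-- Values of the complex Schwartz heat kernel: `heatKernelSchwartz E t x = (heatKernel t x : ℂ)`
(`0 < t`). [folklore] -/
@[simp]
theorem heatKernelSchwartz_apply {t : ℝ} (ht : 0 < t) (x : E) :
    heatKernelSchwartz E t x = (UnboundedOperators.heatKernel t x : ℂ) := by
  rw [heatKernelSchwartz, smul_apply, gaussianSchwartz_apply (by positivity),
    UnboundedOperators.heatKernel_eq, smul_eq_mul]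
  push_cast
  ring

/-- The complex Schwartz heat kernel as a function (`0 < t`). [folklore] -/
theorem coe_heatKernelSchwartz {t : ℝ} (ht : 0 < t) :
    ⇑(heatKernelSchwartz E t) = fun x : E => (UnboundedOperators.heatKernel t x : ℂ) :=
  funext (heatKernelSchwartz_apply ht)

variable [FiniteDimensional ℝ E] [MeasurableSpace E] [BorelSpace E]

/-- **`𝓕 W_t = e^{-(2π)² t ‖·‖²}` in `𝓢`**: the Fourier transform of the Schwartz heat kernel is the
Schwartz heat symbol (`Literature.Analysis.UnboundedOperators.fourierIntegral_heatKernel_holds` lifted to `𝓢(E, ℂ)`), `0 < t`.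
Stein, *Singular Integrals*, Ch. III §2.1 (α). [cite: SteinSingularIntegrals1970, Ch. III §2.1 (α)] -/
theorem fourier_heatKernelSchwartz {t : ℝ} (ht : 0 < t) :
    𝓕 (heatKernelSchwartz E t) = gaussianSchwartz E ((2 * π) ^ 2 * t) := by
  ext ξ
  rw [SchwartzMap.fourier_coe, coe_heatKernelSchwartz ht, UnboundedOperators.fourierIntegral_heatKernel_holds ht ξ,
    gaussianSchwartz_heatSymbol_apply ht]

/-- **`W_t = 𝓕⁻¹ e^{-(2π)² t ‖·‖²}` in `𝓢`** (Fourier inversion on `𝓢(E, ℂ)`), `0 < t`.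
Stein, *Singular Integrals*, Ch. III §2.1. [cite: SteinSingularIntegrals1970, Ch. III §2.1] -/
theorem fourierInv_gaussianSchwartz_heatSymbol {t : ℝ} (ht : 0 < t) :
    𝓕⁻ (gaussianSchwartz E ((2 * π) ^ 2 * t)) = heatKernelSchwartz E t := by
  rw [← fourier_heatKernelSchwartz ht, FourierTransform.fourierInv_fourier_eq]

end HeatKernel

/-! ## Derivatives of the heat kernel: integrability, bounds, scaling -/

section Derivatives

variable {E : Type*} [NormedAddCommGroup E] [InnerProductSpace ℝ E]

/-- The heat kernel is smooth in space (inline form of `Literature.contDiff_heatKernel` of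
`BMOCarlesonProofs.lean`, not imported here). [folklore] -/
theorem contDiff_heatKernel' (t : ℝ) {n : WithTop ℕ∞} : ContDiff ℝ n (UnboundedOperators.heatKernel (E := E) t) := by
  have : UnboundedOperators.heatKernel (E := E) t = fun x => (4 * π * t) ^ (-(Module.finrank ℝ E : ℝ) / 2) *
      Real.exp (-(1 / (4 * t)) * ‖x‖ ^ 2) := funext (UnboundedOperators.heatKernel_eq t)
  rw [this]
  exact contDiff_const.mul (contDiff_exp_neg_mul_norm_sq _)

/-- The derivatives `Dⁿ W_t` of the heat kernel are continuous in space. [folklore] -/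
theorem continuous_iteratedFDeriv_heatKernel (t : ℝ) (n : ℕ) :
    Continuous (iteratedFDeriv ℝ n (UnboundedOperators.heatKernel (E := E) t)) :=
  (contDiff_heatKernel' t (n := ∞)).continuous_iteratedFDeriv (mod_cast le_top)

variable [FiniteDimensional ℝ E] [MeasurableSpace E] [BorelSpace E]

/-- **All derivatives of the heat kernel are integrable against all polynomial weights**:
`x ↦ ‖x‖ᵏ ‖Dⁿ W_t (x)‖ ∈ L¹` for `0 < t` (Schwartz decay, Mathlib's
`SchwartzMap.integrable_pow_mul_iteratedFDeriv`). [folklore] -/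
theorem integrable_pow_mul_norm_iteratedFDeriv_heatKernel {t : ℝ} (ht : 0 < t) (k n : ℕ) :
    Integrable (fun x : E => ‖x‖ ^ k * ‖iteratedFDeriv ℝ n (UnboundedOperators.heatKernel t) x‖) := by
  have h := (heatKernelSchwartzReal E t).integrable_pow_mul_iteratedFDeriv volume k n
  rwa [coe_heatKernelSchwartzReal ht] at h

/-- **The derivatives `Dⁿ W_t` of the heat kernel are integrable** (`0 < t`). [folklore] -/
theorem integrable_iteratedFDeriv_heatKernel {t : ℝ} (ht : 0 < t) (n : ℕ) :
    Integrable (iteratedFDeriv ℝ n (UnboundedOperators.heatKernel (E := E) t)) := by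
  refine (integrable_pow_mul_norm_iteratedFDeriv_heatKernel ht 0 n).mono'
    (continuous_iteratedFDeriv_heatKernel t n).aestronglyMeasurable (Eventually.of_forall fun x => ?_)
  simp

omit [FiniteDimensional ℝ E] [MeasurableSpace E] [BorelSpace E] in
/-- **The derivatives `Dⁿ W_t` of the heat kernel are bounded** (`0 < t`): there is `C` with
`‖Dⁿ W_t (x)‖ ≤ C` for all `x` (the Schwartz seminorm `p_{0,n}`). [folklore] -/
theorem exists_norm_iteratedFDeriv_heatKernel_le {t : ℝ} (ht : 0 < t) (n : ℕ) :
    ∃ C : ℝ, 0 ≤ C ∧ ∀ x : E, ‖iteratedFDeriv ℝ n (UnboundedOperators.heatKernel t) x‖ ≤ C := by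
  refine ⟨SchwartzMap.seminorm ℝ 0 n (heatKernelSchwartzReal E t), apply_nonneg _ _, fun x => ?_⟩
  have h := SchwartzMap.norm_iteratedFDeriv_le_seminorm ℝ (heatKernelSchwartzReal E t) n x
  rwa [coe_heatKernelSchwartzReal ht] at h

omit [FiniteDimensional ℝ E] [MeasurableSpace E] [BorelSpace E] in
/-- Weighted sup bound: `‖x‖ᵏ ‖Dⁿ W_t (x)‖ ≤ C` for all `x` (`0 < t`; the Schwartz seminorm
`p_{k,n}`). [folklore] -/
theorem exists_pow_mul_norm_iteratedFDeriv_heatKernel_le {t : ℝ} (ht : 0 < t) (k n : ℕ) :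
    ∃ C : ℝ, 0 ≤ C ∧ ∀ x : E, ‖x‖ ^ k * ‖iteratedFDeriv ℝ n (UnboundedOperators.heatKernel t) x‖ ≤ C := by
  refine ⟨SchwartzMap.seminorm ℝ k n (heatKernelSchwartzReal E t), apply_nonneg _ _, fun x => ?_⟩
  have h := SchwartzMap.le_seminorm ℝ k n (heatKernelSchwartzReal E t) x
  rwa [coe_heatKernelSchwartzReal ht] at h

omit [FiniteDimensional ℝ E] [MeasurableSpace E] [BorelSpace E] in
/-- **Parabolic scaling of the heat kernel**: `W_s (x) = (√s)^{-d} W_1 (x/√s)` for `0 < s`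
(`Literature.Analysis.UnboundedOperators.heatKernel_one_eq_sqrt_pow_mul_heatKernel` read backwards). Evans, *PDE*, §2.3.1. [folklore] -/
theorem heatKernel_eq_inv_sqrt_pow_mul {s : ℝ} (hs : 0 < s) (x : E) :
    UnboundedOperators.heatKernel s x = (Real.sqrt s ^ Module.finrank ℝ E)⁻¹ * UnboundedOperators.heatKernel 1 ((Real.sqrt s)⁻¹ • x) := by
  have hR : 0 < Real.sqrt s := Real.sqrt_pos.2 hs
  have h := UnboundedOperators.heatKernel_one_eq_sqrt_pow_mul_heatKernel hs ((Real.sqrt s)⁻¹ • x)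
  rw [smul_smul, mul_inv_cancel₀ hR.ne', one_smul] at h
  rw [h, ← mul_assoc, inv_mul_cancel₀ (pow_pos hR _).ne', one_mul]

omit [FiniteDimensional ℝ E] [MeasurableSpace E] [BorelSpace E] in
/-- Function form of the parabolic scaling: `W_s = (√s)^{-d} • (W_1 ∘ ((√s)⁻¹ • ·))`, `0 < s`.
Evans, *PDE*, §2.3.1. [folklore] -/
theorem heatKernel_eq_comp_smul {s : ℝ} (hs : 0 < s) :
    UnboundedOperators.heatKernel (E := E) s = fun x => (Real.sqrt s ^ Module.finrank ℝ E)⁻¹ *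
      (UnboundedOperators.heatKernel 1 ∘ ⇑((Real.sqrt s)⁻¹ • ContinuousLinearMap.id ℝ E)) x := by
  funext x
  rw [heatKernel_eq_inv_sqrt_pow_mul hs x]
  rfl

omit [InnerProductSpace ℝ E] [FiniteDimensional ℝ E] [MeasurableSpace E] [BorelSpace E] in
/-- Composing a continuous multilinear map with the dilation `c • id` in every slot multiplies it
by `cⁿ`. [folklore] -/
theorem _root_.ContinuousMultilinearMap.compContinuousLinearMap_smul_id [NormedSpace ℝ E]
    {G : Type*} [NormedAddCommGroup G] [NormedSpace ℝ G] {n : ℕ}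
    (A : ContinuousMultilinearMap ℝ (fun _ : Fin n => E) G) (c : ℝ) :
    A.compContinuousLinearMap (fun _ => c • ContinuousLinearMap.id ℝ E) = c ^ n • A := by
  ext m
  simp only [ContinuousMultilinearMap.compContinuousLinearMap_apply, ContinuousLinearMap.id_apply,
    smul_apply]
  rw [A.map_smul_univ (fun _ => c) m, Finset.prod_const, Finset.card_univ, Fintype.card_fin]

omit [FiniteDimensional ℝ E] [MeasurableSpace E] [BorelSpace E] in
/-- **Parabolic scaling of the derivatives of the heat kernel**:
`Dⁿ W_s (x) = (√s)^{-d} (√s)^{-n} (Dⁿ W_1)(x/√s)` for `0 < s` (chain rule for the dilation,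
`ContinuousLinearMap.iteratedFDeriv_comp_right`). Evans, *PDE*, §2.3.1. [folklore] -/
theorem iteratedFDeriv_heatKernel_eq_smul {s : ℝ} (hs : 0 < s) (n : ℕ) (x : E) :
    iteratedFDeriv ℝ n (UnboundedOperators.heatKernel s) x =
      ((Real.sqrt s ^ Module.finrank ℝ E)⁻¹ * (Real.sqrt s)⁻¹ ^ n) •
        iteratedFDeriv ℝ n (UnboundedOperators.heatKernel 1) ((Real.sqrt s)⁻¹ • x) := by
  set g : E →L[ℝ] E := (Real.sqrt s)⁻¹ • ContinuousLinearMap.id ℝ E with hg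
  have hcomp : ContDiff ℝ ∞ (UnboundedOperators.heatKernel (E := E) 1 ∘ ⇑g) := (contDiff_heatKernel' 1).comp g.contDiff
  rw [heatKernel_eq_comp_smul hs]
  change iteratedFDeriv ℝ n (fun x => (Real.sqrt s ^ Module.finrank ℝ E)⁻¹ • (UnboundedOperators.heatKernel 1 ∘ ⇑g) x) x = _
  have hn : ContDiffAt ℝ n (UnboundedOperators.heatKernel (E := E) 1 ∘ ⇑g) x := (hcomp.of_le (mod_cast le_top)).contDiffAt
  rw [iteratedFDeriv_const_smul_apply' hn,
    g.iteratedFDeriv_comp_right (contDiff_heatKernel' 1) x (i := n) (mod_cast le_top), hg,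
    ContinuousMultilinearMap.compContinuousLinearMap_smul_id, smul_smul]
  rfl

omit [FiniteDimensional ℝ E] [MeasurableSpace E] [BorelSpace E] in
/-- Norm form of the parabolic scaling: `‖Dⁿ W_s (x)‖ = (√s)^{-d} (√s)^{-n} ‖(Dⁿ W_1)(x/√s)‖`,
`0 < s`. [folklore] -/
theorem norm_iteratedFDeriv_heatKernel_eq {s : ℝ} (hs : 0 < s) (n : ℕ) (x : E) :
    ‖iteratedFDeriv ℝ n (UnboundedOperators.heatKernel s) x‖ =
      (Real.sqrt s ^ Module.finrank ℝ E)⁻¹ * (Real.sqrt s)⁻¹ ^ n *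
        ‖iteratedFDeriv ℝ n (UnboundedOperators.heatKernel 1) ((Real.sqrt s)⁻¹ • x)‖ := by
  have hR : 0 < Real.sqrt s := Real.sqrt_pos.2 hs
  rw [iteratedFDeriv_heatKernel_eq_smul hs, norm_smul, Real.norm_of_nonneg (by positivity)]

omit [FiniteDimensional ℝ E] [MeasurableSpace E] [BorelSpace E] in
/-- **Uniform bound with scaling**: `‖Dⁿ W_s (x)‖ ≤ (√s)^{-(d+n)} sup ‖Dⁿ W_1‖` for `0 < s`, with
the constant of `Literature.Analysis.FunctionSpaces.exists_norm_iteratedFDeriv_heatKernel_le` at `s = 1`. Lemarié-Rieusset 2016,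
§4.5 (scaling of the kernels). [folklore] -/
theorem norm_iteratedFDeriv_heatKernel_le_of_forall_le {n : ℕ} {C : ℝ}
    (hC : ∀ y : E, ‖iteratedFDeriv ℝ n (UnboundedOperators.heatKernel 1) y‖ ≤ C) {s : ℝ} (hs : 0 < s) (x : E) :
    ‖iteratedFDeriv ℝ n (UnboundedOperators.heatKernel s) x‖ ≤
      (Real.sqrt s ^ Module.finrank ℝ E)⁻¹ * (Real.sqrt s)⁻¹ ^ n * C := by
  have hR : 0 < Real.sqrt s := Real.sqrt_pos.2 hs
  rw [norm_iteratedFDeriv_heatKernel_eq hs]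
  exact mul_le_mul_of_nonneg_left (hC _) (by positivity)

/-- **`L¹` scaling of the derivatives**: `∫ ‖Dⁿ W_s‖ = (√s)^{-n} ∫ ‖Dⁿ W_1‖` for `0 < s` (the
substitution `x = √s y`, `Measure.integral_comp_smul`). Lemarié-Rieusset 2016, §4.5. [folklore] -/
theorem integral_norm_iteratedFDeriv_heatKernel_eq {s : ℝ} (hs : 0 < s) (n : ℕ) :
    ∫ x : E, ‖iteratedFDeriv ℝ n (UnboundedOperators.heatKernel s) x‖ =
      (Real.sqrt s)⁻¹ ^ n * ∫ x : E, ‖iteratedFDeriv ℝ n (UnboundedOperators.heatKernel 1) x‖ := by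
  have hR : 0 < Real.sqrt s := Real.sqrt_pos.2 hs
  set d : ℕ := Module.finrank ℝ E with hd
  simp_rw [norm_iteratedFDeriv_heatKernel_eq hs, integral_const_mul]
  rw [Measure.integral_comp_smul volume (fun y : E => ‖iteratedFDeriv ℝ n (UnboundedOperators.heatKernel 1) y‖)
    (Real.sqrt s)⁻¹]
  have hpow : |((Real.sqrt s)⁻¹ ^ d)⁻¹| = Real.sqrt s ^ d := by
    rw [inv_pow, inv_inv, abs_of_pos (pow_pos hR _)]
  rw [← hd, hpow, smul_eq_mul]
  have hne : Real.sqrt s ^ d ≠ 0 := (pow_pos hR _).ne'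
  field_simp

/-- `L¹` scaling in `ℝ≥0∞` form: `∫⁻ ‖Dⁿ W_s‖ₑ = (√s)^{-n} ∫⁻ ‖Dⁿ W_1‖ₑ`, `0 < s`. [folklore] -/
theorem lintegral_enorm_iteratedFDeriv_heatKernel_eq {s : ℝ} (hs : 0 < s) (n : ℕ) :
    ∫⁻ x : E, ‖iteratedFDeriv ℝ n (UnboundedOperators.heatKernel s) x‖ₑ =
      ENNReal.ofReal ((Real.sqrt s)⁻¹ ^ n) * ∫⁻ x : E, ‖iteratedFDeriv ℝ n (UnboundedOperators.heatKernel 1) x‖ₑ := by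
  have hR : 0 < Real.sqrt s := Real.sqrt_pos.2 hs
  rw [← ofReal_integral_norm_eq_lintegral_enorm (integrable_iteratedFDeriv_heatKernel hs n),
    ← ofReal_integral_norm_eq_lintegral_enorm (integrable_iteratedFDeriv_heatKernel one_pos n),
    integral_norm_iteratedFDeriv_heatKernel_eq hs, ENNReal.ofReal_mul (by positivity)]

omit [FiniteDimensional ℝ E] [MeasurableSpace E] [BorelSpace E] in
/-- **Joint continuity of `(s, x) ↦ Dⁿ W_s (x)` on `(0, ∞) × E`** (from the scaling formula
`Literature.Analysis.FunctionSpaces.iteratedFDeriv_heatKernel_eq_smul`). [folklore] -/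
theorem continuousOn_iteratedFDeriv_heatKernel_uncurry (n : ℕ) :
    ContinuousOn (fun p : ℝ × E => iteratedFDeriv ℝ n (UnboundedOperators.heatKernel p.1) p.2) (Ioi 0 ×ˢ univ) := by
  have hinv : ContinuousOn (fun p : ℝ × E => (Real.sqrt p.1)⁻¹) (Ioi 0 ×ˢ univ) :=
    ContinuousOn.inv₀ (by fun_prop) fun p hp => (Real.sqrt_pos.2 (mem_prod.1 hp).1).ne'
  have hc : ContinuousOn (fun p : ℝ × E =>
      ((Real.sqrt p.1 ^ Module.finrank ℝ E)⁻¹ * (Real.sqrt p.1)⁻¹ ^ n : ℝ)) (Ioi 0 ×ˢ univ) := by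
    refine ContinuousOn.mul (ContinuousOn.inv₀ (by fun_prop) fun p hp => ?_) (hinv.pow n)
    exact (pow_pos (Real.sqrt_pos.2 (mem_prod.1 hp).1) _).ne'
  have hD : ContinuousOn (fun p : ℝ × E =>
      iteratedFDeriv ℝ n (UnboundedOperators.heatKernel (E := E) 1) ((Real.sqrt p.1)⁻¹ • p.2)) (Ioi 0 ×ˢ univ) :=
    (continuous_iteratedFDeriv_heatKernel 1 n).comp_continuousOn (hinv.smul continuousOn_snd)
  have hcont : ContinuousOn (fun p : ℝ × E =>
      ((Real.sqrt p.1 ^ Module.finrank ℝ E)⁻¹ * (Real.sqrt p.1)⁻¹ ^ n) •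
        iteratedFDeriv ℝ n (UnboundedOperators.heatKernel (E := E) 1) ((Real.sqrt p.1)⁻¹ • p.2)) (Ioi 0 ×ˢ univ) :=
    hc.smul hD
  refine hcont.congr fun p hp => ?_
  exact iteratedFDeriv_heatKernel_eq_smul (mem_prod.1 hp).1 n p.2

end Derivatives

/-! ## The Fourier transform of the derivatives of the heat kernel -/

section Fourier

variable {E : Type*} [NormedAddCommGroup E] [InnerProductSpace ℝ E] [FiniteDimensional ℝ E]
  [MeasurableSpace E] [BorelSpace E]

omit [FiniteDimensional ℝ E] [MeasurableSpace E] [BorelSpace E] in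
/-- The complex heat kernel is the real one followed by `ℝ → ℂ`. [folklore] -/
theorem ofReal_heatKernel_eq_comp (t : ℝ) :
    (fun x : E => (UnboundedOperators.heatKernel t x : ℂ)) = Complex.ofRealCLM ∘ UnboundedOperators.heatKernel t :=
  rfl

omit [FiniteDimensional ℝ E] [MeasurableSpace E] [BorelSpace E] in
/-- The complex heat kernel is smooth. [folklore] -/
theorem contDiff_ofReal_heatKernel (t : ℝ) {n : WithTop ℕ∞} :
    ContDiff ℝ n (fun x : E => (UnboundedOperators.heatKernel t x : ℂ)) := by
  rw [ofReal_heatKernel_eq_comp]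
  exact Complex.ofRealCLM.contDiff.comp (contDiff_heatKernel' t)

omit [FiniteDimensional ℝ E] [MeasurableSpace E] [BorelSpace E] in
/-- The derivatives of the complex heat kernel are those of the real one followed by `ℝ → ℂ`.
[folklore] -/
theorem iteratedFDeriv_ofReal_heatKernel (t : ℝ) (n : ℕ) (x : E) :
    iteratedFDeriv ℝ n (fun x : E => (UnboundedOperators.heatKernel t x : ℂ)) x =
      Complex.ofRealCLM.compContinuousMultilinearMap (iteratedFDeriv ℝ n (UnboundedOperators.heatKernel t) x) := by
  rw [ofReal_heatKernel_eq_comp]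
  exact Complex.ofRealCLM.iteratedFDeriv_comp_left ((contDiff_heatKernel' t (n := ∞)).contDiffAt)
    (mod_cast le_top)

omit [FiniteDimensional ℝ E] [MeasurableSpace E] [BorelSpace E] in
/-- The derivatives of the complex heat kernel have the same norms as those of the real one.
[folklore] -/
theorem norm_iteratedFDeriv_ofReal_heatKernel (t : ℝ) (n : ℕ) (x : E) :
    ‖iteratedFDeriv ℝ n (fun x : E => (UnboundedOperators.heatKernel t x : ℂ)) x‖ = ‖iteratedFDeriv ℝ n (UnboundedOperators.heatKernel t) x‖ := by
  rw [ofReal_heatKernel_eq_comp]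
  exact Complex.ofRealLI.norm_iteratedFDeriv_comp_left ((contDiff_heatKernel' t (n := ∞)).contDiffAt)
    (mod_cast le_top)

/-- The derivatives of the complex heat kernel are integrable (`0 < t`). [folklore] -/
theorem integrable_iteratedFDeriv_ofReal_heatKernel {t : ℝ} (ht : 0 < t) (n : ℕ) :
    Integrable (iteratedFDeriv ℝ n (fun x : E => (UnboundedOperators.heatKernel t x : ℂ))) := by
  refine (integrable_pow_mul_norm_iteratedFDeriv_heatKernel ht 0 n).mono'
    ((contDiff_ofReal_heatKernel t (n := ∞)).continuous_iteratedFDeriv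
      (mod_cast le_top)).aestronglyMeasurable (Eventually.of_forall fun x => ?_)
  rw [norm_iteratedFDeriv_ofReal_heatKernel]
  simp

/-- **Fourier transform of the derivatives of the heat kernel** (`0 < t`):
`𝓕 (Dⁿ W_t) = ξ ↦ (2πi ⟪ξ, ·⟫)^{⊗n} e^{-(2π)² t ‖ξ‖²}`, in Mathlib's packaging
`fourierPowSMulRight (-innerSL ℝ) heatSymbol` (`Real.fourier_iteratedFDeriv` with
`Literature.Analysis.UnboundedOperators.fourierIntegral_heatKernel_holds`). [folklore] -/
theorem fourier_iteratedFDeriv_heatKernel {t : ℝ} (ht : 0 < t) (n : ℕ) :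
    𝓕 (iteratedFDeriv ℝ n (fun x : E => (UnboundedOperators.heatKernel t x : ℂ))) = fun ξ =>
      VectorFourier.fourierPowSMulRight (-innerSL ℝ) (fun ξ : E => (UnboundedOperators.heatSymbol t ξ : ℂ)) ξ n := by
  have hF : 𝓕 (fun x : E => (UnboundedOperators.heatKernel t x : ℂ)) = fun ξ : E => (UnboundedOperators.heatSymbol t ξ : ℂ) :=
    funext fun ξ => UnboundedOperators.fourierIntegral_heatKernel_holds ht ξ
  rw [Real.fourier_iteratedFDeriv (N := (n : ℕ∞)) (contDiff_ofReal_heatKernel t)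
    (fun k _ => integrable_iteratedFDeriv_ofReal_heatKernel ht k) le_rfl, hF]

/-- **Fourier transform of the derivatives of the heat kernel, evaluated**:
`𝓕 (Dⁿ W_t) (ξ) (m₁, …, mₙ) = (2πi)ⁿ ⟪ξ, m₁⟫ ⋯ ⟪ξ, mₙ⟫ e^{-(2π)² t ‖ξ‖²}` (`0 < t`).
[folklore] -/
theorem fourier_iteratedFDeriv_heatKernel_apply {t : ℝ} (ht : 0 < t) (n : ℕ) (ξ : E)
    (m : Fin n → E) :
    𝓕 (iteratedFDeriv ℝ n (fun x : E => (UnboundedOperators.heatKernel t x : ℂ))) ξ m =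
      (2 * π * Complex.I) ^ n * (∏ i, (⟪ξ, m i⟫ : ℂ)) * (UnboundedOperators.heatSymbol t ξ : ℂ) := by
  rw [fourier_iteratedFDeriv_heatKernel ht n]
  dsimp only
  rw [VectorFourier.fourierPowSMulRight_apply]
  have hL : ∀ i, (-innerSL ℝ (E := E)) ξ (m i) = -⟪ξ, m i⟫ := fun i => rfl
  simp_rw [hL, Finset.prod_neg, Finset.card_univ, Fintype.card_fin, smul_eq_mul, Complex.real_smul]
  push_cast
  have key : (-(2 * (π : ℂ) * Complex.I)) ^ n * (-1 : ℂ) ^ n = (2 * π * Complex.I) ^ n := by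
    rw [← mul_pow]; ring
  calc (-(2 * ↑π * Complex.I)) ^ n * ((-1) ^ n * (∏ i, (⟪ξ, m i⟫ : ℂ)) * (UnboundedOperators.heatSymbol t ξ : ℂ))
      = (-(2 * ↑π * Complex.I)) ^ n * (-1) ^ n * (∏ i, (⟪ξ, m i⟫ : ℂ)) * (UnboundedOperators.heatSymbol t ξ : ℂ) := by
        ring
    _ = _ := by rw [key]

/-- The scalar entries `x ↦ (Dⁿ W_t (x) (m₁, …, mₙ) : ℂ)` of the derivatives of the heat kernel are
integrable (`0 < t`). [folklore] -/
theorem integrable_iteratedFDeriv_heatKernel_apply_ofReal {t : ℝ} (ht : 0 < t) (n : ℕ)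
    (m : Fin n → E) :
    Integrable (fun x : E => ((iteratedFDeriv ℝ n (UnboundedOperators.heatKernel t) x m : ℝ) : ℂ)) := by
  have hmeas : AEStronglyMeasurable (fun x : E => ((iteratedFDeriv ℝ n (UnboundedOperators.heatKernel t) x m : ℝ) : ℂ))
      volume :=
    (Complex.continuous_ofReal.comp ((ContinuousMultilinearMap.apply ℝ (fun _ : Fin n => E) ℝ
      m).continuous.comp (continuous_iteratedFDeriv_heatKernel t n))).aestronglyMeasurable
  refine ((integrable_iteratedFDeriv_heatKernel ht n).norm.mul_const (∏ i, ‖m i‖)).mono' hmeas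
    (Eventually.of_forall fun x => ?_)
  rw [Complex.norm_real]
  exact (iteratedFDeriv ℝ n (UnboundedOperators.heatKernel t) x).le_opNorm m

/-- **Fourier transform of the scalar entries of the derivatives of the heat kernel**:
`𝓕 (x ↦ Dⁿ W_t (x) (m₁, …, mₙ)) (ξ) = (2πi)ⁿ ⟪ξ, m₁⟫ ⋯ ⟪ξ, mₙ⟫ e^{-(2π)² t ‖ξ‖²}` (`0 < t`; the
form consumed by the Oseen kernel). [folklore] -/
theorem fourier_iteratedFDeriv_heatKernel_apply_ofReal {t : ℝ} (ht : 0 < t) (n : ℕ) (m : Fin n → E)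
    (ξ : E) :
    𝓕 (fun x : E => ((iteratedFDeriv ℝ n (UnboundedOperators.heatKernel t) x m : ℝ) : ℂ)) ξ =
      (2 * π * Complex.I) ^ n * (∏ i, (⟪ξ, m i⟫ : ℂ)) * (UnboundedOperators.heatSymbol t ξ : ℂ) := by
  have h := fourier_iteratedFDeriv_heatKernel_apply ht n ξ m
  rw [Real.fourier_continuousMultilinearMap_apply (integrable_iteratedFDeriv_ofReal_heatKernel ht n)]
    at h
  rw [← h]
  have hfun : (fun x : E => ((iteratedFDeriv ℝ n (UnboundedOperators.heatKernel t) x m : ℝ) : ℂ)) =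
      fun x => iteratedFDeriv ℝ n (fun x : E => (UnboundedOperators.heatKernel t x : ℂ)) x m := by
    funext x
    rw [iteratedFDeriv_ofReal_heatKernel, ContinuousLinearMap.compContinuousMultilinearMap_coe,
      comp_apply, Complex.ofRealCLM_apply]
  rw [hfun]

end Fourier

end Literature.Analysis.FunctionSpaces
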